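import Mathlib
import Summits.ValiantsHypothesis.ValiantsHypothesis.Theses.ValuativeGCT

/-!
# `CutBites` — negative lemma: NO EDMONDS GAP ⇒ NO CUT (the column compression space never cuts)

Crux `stmt-ValiantsHypothesis-12626` (`Theses.ValuativeGCT.CutBites`, route ValuativeGCT; the same
truncation is the `T_U` of `ValuativeFlip` / `ValuativeBound`, stmt-12624/12625).  Standing disprover
(cdisprove gen 2), `Cruxes/CutBites/Disproof.lean` §F, restated over the crux's literal `let`-blocks
with the skew space replaced by the compression space `U_col = {X ∈ Mat_m : column 0 of X = 0}`
(`m = n + 1`; generic rank `r = m - 1`, and `rk = ncrk`: NO Edmonds gap).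

* `linSubst_colDiagonal_detFormLex` — the torus element `M_q : X ↦ X · diag(q)` with `∏ q = 1` lies in
  the `End`-stabiliser of `det_m` (for every `q`).
* `cutBites_truncCol_eq` — with `q = ((1/2)^n, 2, …, 2)`, invariance forces every monomial of an
  `H`-invariant form of degree `mδ` to have degree EXACTLY `δ` in the column-0 coordinates, so it lies
  in `P_{U_col}^δ`: for every `m ≥ 1`, `δ`, `λ` and every threshold `t ≤ δ`, `T_{U_col}(t) = T_{U_col}(0)`.
  The route threshold for `U_col` is `δ(m - r) = δ`: the valuative truncation is VACUOUS there.
* `cutBites_false_for_every_rank_bounded_space` — hence the strengthening of the crux in the exact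
  binder shape of `ValuativeFlip` ("for EVERY non-zero singular space `U` of rank `≤ r < m` some
  `(δ, λ)` is cut at threshold `δ(m-r)`") is FALSE (witness `m = 3`, `U_col`, `r = 2`).  What the crux
  uses about `Λ_m` is precisely its Edmonds gap (`rk Λ_m = m - 1 < ncrk Λ_m = m`); paper dichotomy:
  the cut at threshold `δ(m - rk U)` bites iff `ncrk U > rk U`.
[folklore]
-/

namespace Summit.ValiantsHypothesis.ValiantsHypothesis.Theorems.CutBites.Negative

open Literature.NumberTheory.DiophantineGeometry Literature.Computability.AlgebraicComplexity
open MvPolynomial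
open scoped BigOperators Matrix

noncomputable section

variable {n : ℕ}

/-! ### The compression space -/

/-- Vectors of `U_col = span {column 0 = 0}` have vanishing column 0. [folklore] -/
theorem apply_col_zero_of_mem_span_col {m : ℕ} [NeZero m] {u : MatIdx m → ℂ}
    (hu : u ∈ Submodule.span ℂ {u : MatIdx m → ℂ | ∀ a : Fin m, u (toLex (a, 0)) = 0}) (a : Fin m) :
    u (toLex (a, 0)) = 0 := by
  induction hu using Submodule.span_induction generalizing a with
  | mem x hx => exact hx a
  | zero => simp
  | add x y _ _ hx hy => rw [Pi.add_apply, hx, hy, add_zero]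
  | smul c x _ hx => rw [Pi.smul_apply, hx, smul_zero]

/-- Every element of `U_col` has rank `≤ m - 1 = n`. [folklore] -/
theorem rank_le_of_mem_span_col {u : MatIdx (n + 1) → ℂ}
    (hu : u ∈ Submodule.span ℂ {u : MatIdx (n + 1) → ℂ | ∀ a : Fin (n + 1), u (toLex (a, 0)) = 0}) :
    (Matrix.of fun a b : Fin (n + 1) => u (toLex (a, b))).rank ≤ n := by
  set X : Matrix (Fin (n + 1)) (Fin (n + 1)) ℂ := Matrix.of fun a b => u (toLex (a, b)) with hXdef
  have hX : X = X.submatrix id Fin.succ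
      * Matrix.of (fun (i : Fin n) (b : Fin (n + 1)) => if b = i.succ then (1 : ℂ) else 0) := by
    ext a b
    rw [Matrix.mul_apply]
    by_cases hb : b = 0
    · subst hb
      simp [hXdef, apply_col_zero_of_mem_span_col hu a, (Fin.succ_ne_zero _).symm]
    · obtain ⟨i, rfl⟩ := Fin.exists_succ_eq.mpr hb
      simp [Fin.succ_inj]
  rw [hX]
  exact (Matrix.rank_mul_le_left _ _).trans (Matrix.rank_le_width _)

/-- `U_col ≠ 0` for `m ≥ 2`. [folklore] -/
theorem span_col_ne_bot (k : ℕ) :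
    Submodule.span ℂ {u : MatIdx (k + 2) → ℂ | ∀ a : Fin (k + 2), u (toLex (a, 0)) = 0} ≠ ⊥ := by
  intro h
  have hmem : (fun i : MatIdx (k + 2) =>
      if i = toLex ((0 : Fin (k + 2)), (1 : Fin (k + 2))) then (1 : ℂ) else 0)
      ∈ Submodule.span ℂ {u : MatIdx (k + 2) → ℂ | ∀ a : Fin (k + 2), u (toLex (a, 0)) = 0} := by
    refine Submodule.subset_span fun a => ?_
    simp
  rw [h, Submodule.mem_bot] at hmem
  have := congr_fun hmem (toLex ((0 : Fin (k + 2)), (1 : Fin (k + 2))))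
  simp at this

/-! ### The torus element `M_q = diag(q_col)` and its action -/

/-- `linSubst` of the diagonal matrix `diag(q_{col i})` rescales the variable `X_(a,b)` by `q_b`.
[folklore] -/
theorem linSubst_colDiagonal {m : ℕ} (q : Fin m → ℂ) :
    linSubst (MatIdx m) ℂ (Matrix.diagonal fun i : MatIdx m => q (ofLex i).2)
      = MvPolynomial.aeval (R := ℂ) fun i : MatIdx m =>
          q (ofLex i).2 • (X i : MvPolynomial (MatIdx m) ℂ) := by
  refine MvPolynomial.algHom_ext fun i => ?_
  rw [linSubst_X, aeval_X]
  simp [Matrix.diagonal_apply, ite_smul, Finset.sum_ite_eq']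

/-- **`M_q ∈ Stab_End(det_m)`** whenever `∏ q = 1`: rescaling column `b` by `q_b` fixes `det_m`.
[folklore] -/
theorem linSubst_colDiagonal_detFormLex {m : ℕ} (q : Fin m → ℂ) (hq : ∏ b, q b = 1) :
    linSubst (MatIdx m) ℂ (Matrix.diagonal fun i : MatIdx m => q (ofLex i).2) (detFormLex ℂ m)
      = detFormLex ℂ m := by
  rw [linSubst_colDiagonal, detFormLex, aeval_rename]
  have h1 : MvPolynomial.aeval (R := ℂ) ((fun i : MatIdx m =>
        q (ofLex i).2 • (X i : MvPolynomial (MatIdx m) ℂ)) ∘ toLex) (detPoly (Fin m) ℂ)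
      = Matrix.det (Matrix.of fun i j : Fin m => (fun b : Fin m => C (q b)) j
          * (Matrix.of fun a b : Fin m => (X (toLex (a, b)) : MvPolynomial (MatIdx m) ℂ)) i j) := by
    rw [detPoly, AlgHom.map_det]
    congr 1
    ext a b
    simp [Matrix.mvPolynomialX, smul_eq_C_mul]
  have h2 : rename toLex (detPoly (Fin m) ℂ)
      = Matrix.det (Matrix.of fun a b : Fin m => (X (toLex (a, b)) : MvPolynomial (MatIdx m) ℂ)) := by
    rw [detPoly, AlgHom.map_det]
    congr 1
    ext a b
    simp [Matrix.mvPolynomialX, rename_X]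
  rw [h1, Matrix.det_mul_row, ← map_prod, hq, map_one, one_mul, h2]

/-- The row action `A ↦ A M_q` rescales the coordinate `A(j, (a,b))` by `q_b`. [folklore] -/
theorem rowAct_colDiagonal_eq {m : ℕ} (q : Fin m → ℂ) :
    (MvPolynomial.aeval (R := ℂ) fun p : MatIdx m × MatIdx m =>
        ∑ l : MatIdx m, (Matrix.diagonal fun i : MatIdx m => q (ofLex i).2) l p.2
          • MvPolynomial.X (p.1, l))
      = MvPolynomial.aeval (R := ℂ) fun p : MatIdx m × MatIdx m =>
          q (ofLex p.2).2 • (X p : MvPolynomial (MatIdx m × MatIdx m) ℂ) := by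
  refine MvPolynomial.algHom_ext fun p => ?_
  rw [aeval_X, aeval_X]
  simp [Matrix.diagonal_apply, ite_smul, Finset.sum_ite_eq']

/-- Coefficients under a diagonal rescaling of the variables. [folklore] -/
theorem coeff_aeval_smul_X {σ : Type*} (c : σ → ℂ) (G : MvPolynomial σ ℂ) (α : σ →₀ ℕ) :
    coeff α (MvPolynomial.aeval (R := ℂ) (fun p => c p • (X p : MvPolynomial σ ℂ)) G)
      = (∏ p ∈ α.support, c p ^ α p) * coeff α G := by
  classical
  have hmon : ∀ β : σ →₀ ℕ, MvPolynomial.aeval (R := ℂ) (fun p => c p • (X p : MvPolynomial σ ℂ))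
      (monomial β (coeff β G)) = C (∏ p ∈ β.support, c p ^ β p) * monomial β (coeff β G) := by
    intro β
    rw [aeval_monomial, MvPolynomial.algebraMap_eq, monomial_eq]
    simp only [Finsupp.prod, smul_eq_C_mul, mul_pow, Finset.prod_mul_distrib, ← map_pow, ← map_prod]
    ring
  conv_lhs => rw [G.as_sum]
  rw [map_sum, coeff_sum]
  simp only [hmon, coeff_C_mul, coeff_monomial]
  rw [Finset.sum_eq_single α]
  · rw [if_pos rfl]
  · intro β _ hβ
    rw [if_neg hβ, mul_zero]
  · intro hα
    rw [if_pos rfl, notMem_support_iff.mp hα, mul_zero]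

/-- Invariance under a diagonal rescaling forces weight `1` on every monomial. [folklore] -/
theorem prod_eq_one_of_smul_X_invariant {σ : Type*} {c : σ → ℂ} {G : MvPolynomial σ ℂ}
    (hG : MvPolynomial.aeval (R := ℂ) (fun p => c p • (X p : MvPolynomial σ ℂ)) G = G)
    {α : σ →₀ ℕ} (hα : α ∈ G.support) : ∏ p ∈ α.support, c p ^ α p = 1 := by
  have h := congrArg (coeff α) hG
  rw [coeff_aeval_smul_X] at h
  exact (mul_eq_right₀ (mem_support_iff.mp hα)).mp h

/-- The column weights `q = ((1/2)^n, 2, …, 2)` multiply to `1`. [folklore] -/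
theorem prod_colWeights :
    ∏ b : Fin (n + 1), (fun b : Fin (n + 1) => if b = 0 then (2⁻¹ : ℂ) ^ n else 2) b = 1 := by
  rw [Fin.prod_univ_succ]
  simp only [if_true, Fin.succ_ne_zero, if_false, Finset.prod_const, Finset.card_univ,
    Fintype.card_fin]
  rw [← mul_pow, inv_mul_cancel₀ (two_ne_zero' ℂ), one_pow]

/-- The `M_q`-weight of a monomial in terms of its column-0 degree. [folklore] -/
theorem prod_colWeights_pow (α : MatIdx (n + 1) × MatIdx (n + 1) →₀ ℕ) :
    ∏ p ∈ α.support, (if (ofLex p.2).2 = 0 then (2⁻¹ : ℂ) ^ n else 2) ^ α p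
      = (2⁻¹ : ℂ) ^ (n * ∑ p ∈ α.support with (ofLex p.2).2 = 0, α p)
        * 2 ^ (∑ p ∈ α.support with ¬(ofLex p.2).2 = 0, α p) := by
  rw [← Finset.prod_filter_mul_prod_filter_not α.support (fun p => (ofLex p.2).2 = 0)]
  congr 1
  · rw [pow_mul, ← Finset.prod_pow_eq_pow_sum]
    refine Finset.prod_congr rfl fun p hp => ?_
    rw [if_pos (Finset.mem_filter.mp hp).2]
  · rw [← Finset.prod_pow_eq_pow_sum]
    refine Finset.prod_congr rfl fun p hp => ?_
    rw [if_neg (Finset.mem_filter.mp hp).2]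

/-- Column-0 coordinates vanish on `L_{U_col}`. [folklore] -/
theorem X_mem_vanishingIdeal_col {p : MatIdx (n + 1) × MatIdx (n + 1)} (hp : (ofLex p.2).2 = 0) :
    (X p : MvPolynomial (MatIdx (n + 1) × MatIdx (n + 1)) ℂ) ∈ MvPolynomial.vanishingIdeal ℂ
      {x : MatIdx (n + 1) × MatIdx (n + 1) → ℂ | ∀ j : MatIdx (n + 1), (fun i => x (j, i)) ∈
        Submodule.span ℂ {u : MatIdx (n + 1) → ℂ | ∀ a : Fin (n + 1), u (toLex (a, 0)) = 0}} := by
  rw [mem_vanishingIdeal_iff]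
  intro x hx
  rw [aeval_X]
  have hrow := apply_col_zero_of_mem_span_col (hx p.1) (ofLex p.2).1
  have hp' : toLex ((ofLex p.2).1, (0 : Fin (n + 1))) = p.2 := by
    rw [← hp]
    rfl
  rw [hp'] at hrow
  exact hrow

/-- Lattice bookkeeping: if every element of `Hom ⊓ S` lies in `P^t`, thresholds `t` and `0` agree.
[folklore] -/
theorem inf_pow_eq_inf_pow_zero_of_forall {σ : Type*} (Hom S W : Submodule ℂ (MvPolynomial σ ℂ))
    (P : Ideal (MvPolynomial σ ℂ)) (t : ℕ) (h : ∀ G ∈ Hom, G ∈ S → G ∈ P ^ t) :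
    Hom ⊓ (P ^ t).restrictScalars ℂ ⊓ S ⊓ W = Hom ⊓ (P ^ 0).restrictScalars ℂ ⊓ S ⊓ W := by
  ext G
  simp only [Submodule.mem_inf, pow_zero, Ideal.one_eq_top, Submodule.restrictScalars_mem,
    Submodule.mem_top, and_true]
  constructor
  · rintro ⟨⟨⟨hH, -⟩, hS⟩, hW⟩
    exact ⟨⟨hH, hS⟩, hW⟩
  · rintro ⟨⟨hH, hS⟩, hW⟩
    exact ⟨⟨⟨hH, h G hH hS⟩, hS⟩, hW⟩

/-! ### The theorems, over the crux's literal `let`-blocks with `U := U_col` -/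

/-- **No cut for the compression space.**  For every `m = n + 1 ≥ 1`, every `δ`, every weight `χ`
and every threshold `t ≤ δ`: `T_{U_col}(t) = T_{U_col}(0)` in degree `mδ` (multi-magic: every monomial
of an `H`-invariant has column-0 degree exactly `δ`). [folklore] -/
theorem cutBites_truncCol_eq (n δ t : ℕ) (ht : t ≤ δ) (χ : Weight (MatIdx (n + 1))) :
    (let U : Submodule ℂ (MatIdx (n + 1) → ℂ) :=
        Submodule.span ℂ {u : MatIdx (n + 1) → ℂ | ∀ a : Fin (n + 1), u (toLex (a, 0)) = 0};
      let T : ℕ → Submodule ℂ (MvPolynomial (MatIdx (n + 1) × MatIdx (n + 1)) ℂ) := fun t =>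
        MvPolynomial.homogeneousSubmodule (MatIdx (n + 1) × MatIdx (n + 1)) ℂ ((n + 1) * δ)
        ⊓ ((MvPolynomial.vanishingIdeal ℂ {p : MatIdx (n + 1) × MatIdx (n + 1) → ℂ |
              ∀ j : MatIdx (n + 1), (fun i => p (j, i)) ∈ U}) ^ (t)).restrictScalars ℂ
        ⊓ (⨅ (M : Matrix (MatIdx (n + 1)) (MatIdx (n + 1)) ℂ)
            (_ : linSubst (MatIdx (n + 1)) ℂ M (detFormLex ℂ (n + 1)) = detFormLex ℂ (n + 1)),
            LinearMap.ker ((MvPolynomial.aeval (R := ℂ) fun p : MatIdx (n + 1) × MatIdx (n + 1) =>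
              ∑ l : MatIdx (n + 1), M l p.2 • MvPolynomial.X (p.1, l)).toLinearMap
              - LinearMap.id (R := ℂ) (M := MvPolynomial (MatIdx (n + 1) × MatIdx (n + 1)) ℂ)))
        ⊓ (⨅ (g : Matrix.GeneralLinearGroup (MatIdx (n + 1)) ℂ) (_ : IsUpperTriangular g),
            LinearMap.ker ((MvPolynomial.aeval (R := ℂ) fun p : MatIdx (n + 1) × MatIdx (n + 1) =>
              ∑ l : MatIdx (n + 1), ((g⁻¹ : Matrix.GeneralLinearGroup (MatIdx (n + 1)) ℂ) :
                Matrix (MatIdx (n + 1)) (MatIdx (n + 1)) ℂ) p.1 l • MvPolynomial.X (l, p.2)).toLinearMap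
              - weightChar χ g • LinearMap.id (R := ℂ) (M := MvPolynomial (MatIdx (n + 1) × MatIdx (n + 1)) ℂ)));
      T t = T 0) := by
  intro U T
  refine inf_pow_eq_inf_pow_zero_of_forall _ _ _ _ t fun G hGh hGs => ?_
  have hinv : MvPolynomial.aeval (R := ℂ) (fun p : MatIdx (n + 1) × MatIdx (n + 1) =>
      (if (ofLex p.2).2 = 0 then (2⁻¹ : ℂ) ^ n else 2) • (X p : MvPolynomial (MatIdx (n + 1) × MatIdx (n + 1)) ℂ)) G = G := by
    have h := (Submodule.mem_iInf _).mp ((Submodule.mem_iInf _).mp hGs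
      (Matrix.diagonal fun i : MatIdx (n + 1) => if (ofLex i).2 = 0 then (2⁻¹ : ℂ) ^ n else 2))
      (linSubst_colDiagonal_detFormLex (fun b : Fin (n + 1) => if b = 0 then (2⁻¹ : ℂ) ^ n else 2)
        prod_colWeights)
    rw [LinearMap.mem_ker, LinearMap.sub_apply, sub_eq_zero] at h
    have hre := rowAct_colDiagonal_eq (m := n + 1) (fun b : Fin (n + 1) => if b = 0 then (2⁻¹ : ℂ) ^ n else 2)
    exact (AlgHom.congr_fun hre G).symm.trans h
  rw [G.as_sum]
  refine Ideal.sum_mem _ fun α hα => ?_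
  have hw : ∏ p ∈ α.support, (if (ofLex p.2).2 = 0 then (2⁻¹ : ℂ) ^ n else 2) ^ α p = 1 :=
    prod_eq_one_of_smul_X_invariant hinv hα
  rw [prod_colWeights_pow] at hw
  have hdeg : (∑ p ∈ α.support, α p) = (n + 1) * δ := by
    have := hGh (mem_support_iff.mp hα)
    simpa [Finsupp.weight_apply, Finsupp.sum] using this
  set e0 := ∑ p ∈ α.support with (ofLex p.2).2 = 0, α p with he0
  set e1 := ∑ p ∈ α.support with ¬(ofLex p.2).2 = 0, α p with he1
  have hsum : e0 + e1 = (n + 1) * δ := by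
    rw [he0, he1, Finset.sum_filter_add_sum_filter_not]
    exact hdeg
  have h2 : (2 : ℂ) ^ e1 = 2 ^ (n * e0) := by
    have h3 : (2 : ℂ) ^ (n * e0) * ((2⁻¹ : ℂ) ^ (n * e0) * 2 ^ e1) = 2 ^ (n * e0) := by
      rw [hw, mul_one]
    rwa [← mul_assoc, ← mul_pow, mul_inv_cancel₀ (two_ne_zero' ℂ), one_pow, one_mul] at h3
  have h3 : e1 = n * e0 := Nat.pow_right_injective le_rfl (by exact_mod_cast h2)
  have h4 : e0 = δ := by
    apply Nat.eq_of_mul_eq_mul_left (Nat.succ_pos n)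
    calc (n + 1) * e0 = e0 + n * e0 := by ring
      _ = e0 + e1 := by rw [h3]
      _ = (n + 1) * δ := hsum
  rw [monomial_eq, Finsupp.prod,
    ← Finset.prod_filter_mul_prod_filter_not α.support (fun p => (ofLex p.2).2 = 0)]
  refine Ideal.mul_mem_left _ _ (Ideal.mul_mem_right _ _ ?_)
  have hte : t ≤ e0 := h4 ▸ ht
  refine Ideal.pow_le_pow_right hte ?_
  rw [he0, ← Finset.prod_pow_eq_pow_sum]
  exact Ideal.prod_mem_prod fun p hp =>
    Ideal.pow_mem_pow (X_mem_vanishingIdeal_col (Finset.mem_filter.mp hp).2) _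

/-- At the route threshold `δ(m - r) = δ` (`r = m - 1`) no weight is cut for `U_col`. [folklore] -/
theorem cutBites_not_lt_truncCol (n δ : ℕ) (lam : Nat.Partition ((n + 1) * δ)) :
    (let U : Submodule ℂ (MatIdx (n + 1) → ℂ) :=
        Submodule.span ℂ {u : MatIdx (n + 1) → ℂ | ∀ a : Fin (n + 1), u (toLex (a, 0)) = 0};
      let χ : Weight (MatIdx (n + 1)) := (Weight.dualOfPartition ((n + 1) * (n + 1)) lam).toMatIdx;
      let T : ℕ → Submodule ℂ (MvPolynomial (MatIdx (n + 1) × MatIdx (n + 1)) ℂ) := fun t =>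
        MvPolynomial.homogeneousSubmodule (MatIdx (n + 1) × MatIdx (n + 1)) ℂ ((n + 1) * δ)
        ⊓ ((MvPolynomial.vanishingIdeal ℂ {p : MatIdx (n + 1) × MatIdx (n + 1) → ℂ |
              ∀ j : MatIdx (n + 1), (fun i => p (j, i)) ∈ U}) ^ (t)).restrictScalars ℂ
        ⊓ (⨅ (M : Matrix (MatIdx (n + 1)) (MatIdx (n + 1)) ℂ)
            (_ : linSubst (MatIdx (n + 1)) ℂ M (detFormLex ℂ (n + 1)) = detFormLex ℂ (n + 1)),
            LinearMap.ker ((MvPolynomial.aeval (R := ℂ) fun p : MatIdx (n + 1) × MatIdx (n + 1) =>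
              ∑ l : MatIdx (n + 1), M l p.2 • MvPolynomial.X (p.1, l)).toLinearMap
              - LinearMap.id (R := ℂ) (M := MvPolynomial (MatIdx (n + 1) × MatIdx (n + 1)) ℂ)))
        ⊓ (⨅ (g : Matrix.GeneralLinearGroup (MatIdx (n + 1)) ℂ) (_ : IsUpperTriangular g),
            LinearMap.ker ((MvPolynomial.aeval (R := ℂ) fun p : MatIdx (n + 1) × MatIdx (n + 1) =>
              ∑ l : MatIdx (n + 1), ((g⁻¹ : Matrix.GeneralLinearGroup (MatIdx (n + 1)) ℂ) :
                Matrix (MatIdx (n + 1)) (MatIdx (n + 1)) ℂ) p.1 l • MvPolynomial.X (l, p.2)).toLinearMap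
              - weightChar χ g • LinearMap.id (R := ℂ) (M := MvPolynomial (MatIdx (n + 1) × MatIdx (n + 1)) ℂ)));
      ¬ (Module.finrank ℂ ↥(T δ) < Module.finrank ℂ ↥(T 0))) := by
  intro U χ T
  have key : T δ = T 0 := cutBites_truncCol_eq n δ δ le_rfl χ
  rw [key]
  exact lt_irrefl _

/-- **Refuted strengthening (every singular space).**  In the exact binder shape of `ValuativeFlip`
(`U`, `r`, rank hypothesis, threshold `δ * (m - r)`), the universal version "every non-zero singular
space of rank `≤ r < m` cuts for some `(δ, λ)`" is FALSE: witness `m = 3`, `U = U_col`, `r = 2`.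
[folklore] -/
theorem cutBites_false_for_every_rank_bounded_space :
    ¬ (∀ m : ℕ, 3 ≤ m → ∀ (U : Submodule ℂ (MatIdx m → ℂ)) (r : ℕ),
        (∀ u ∈ U, (Matrix.of fun a b : Fin m => u (toLex (a, b))).rank ≤ r) → r < m → U ≠ ⊥ →
        ∃ (δ : ℕ) (lam : Nat.Partition (m * δ)), lam.parts.card ≤ m * m ∧
          (let χ : Weight (MatIdx m) := (Weight.dualOfPartition (m * m) lam).toMatIdx;
        let T : ℕ → Submodule ℂ (MvPolynomial (MatIdx m × MatIdx m) ℂ) := fun t =>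
        MvPolynomial.homogeneousSubmodule (MatIdx m × MatIdx m) ℂ (m * δ)
        ⊓ ((MvPolynomial.vanishingIdeal ℂ {p : MatIdx m × MatIdx m → ℂ |
              ∀ j : MatIdx m, (fun i => p (j, i)) ∈ U}) ^ (t)).restrictScalars ℂ
        ⊓ (⨅ (M : Matrix (MatIdx m) (MatIdx m) ℂ)
            (_ : linSubst (MatIdx m) ℂ M (detFormLex ℂ m) = detFormLex ℂ m),
            LinearMap.ker ((MvPolynomial.aeval (R := ℂ) fun p : MatIdx m × MatIdx m =>
              ∑ l : MatIdx m, M l p.2 • MvPolynomial.X (p.1, l)).toLinearMap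
              - LinearMap.id (R := ℂ) (M := MvPolynomial (MatIdx m × MatIdx m) ℂ)))
        ⊓ (⨅ (g : Matrix.GeneralLinearGroup (MatIdx m) ℂ) (_ : IsUpperTriangular g),
            LinearMap.ker ((MvPolynomial.aeval (R := ℂ) fun p : MatIdx m × MatIdx m =>
              ∑ l : MatIdx m, ((g⁻¹ : Matrix.GeneralLinearGroup (MatIdx m) ℂ) :
                Matrix (MatIdx m) (MatIdx m) ℂ) p.1 l • MvPolynomial.X (l, p.2)).toLinearMap
              - weightChar χ g • LinearMap.id (R := ℂ) (M := MvPolynomial (MatIdx m × MatIdx m) ℂ)));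
        Module.finrank ℂ ↥(T (δ * (m - r))) < Module.finrank ℂ ↥(T 0))) := by
  intro h
  have hU : ∀ u ∈ Submodule.span ℂ {u : MatIdx (2 + 1) → ℂ | ∀ a : Fin (2 + 1), u (toLex (a, 0)) = 0},
      (Matrix.of fun a b : Fin (2 + 1) => u (toLex (a, b))).rank ≤ 2 :=
    fun u hu => rank_le_of_mem_span_col hu
  obtain ⟨δ, lam, -, hlt⟩ := h (2 + 1) le_rfl _ 2 hU (Nat.lt_succ_self 2) (span_col_ne_bot 1)
  have hthr : δ * (2 + 1 - 2) = δ := by norm_num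
  rw [hthr] at hlt
  exact cutBites_not_lt_truncCol 2 δ lam hlt

end

end Summit.ValiantsHypothesis.ValiantsHypothesis.Theorems.CutBites.Negative
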